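import Mathlib.MeasureTheory.Integral.Bochner.Set
import Mathlib.MeasureTheory.Integral.IntegrableOn
import Mathlib.Analysis.SpecialFunctions.Log.NegMulLog
import Mathlib.Analysis.SpecialFunctions.Pow.Real
import Mathlib.MeasureTheory.Measure.Real
import HarnessLib

/-!
# Score splitting: the measure-theoretic core of Bamler's heat kernel gradient bound
# (Bamler 2020a, §7.4, displays (7.29)–(7.31))

R. Bamler, *Entropy and heat kernel bounds on a Ricci flow background*, arXiv:2008.07093 (2020a),
§7.4 (proof of Thm. 7.5): the directional derivative of the heat kernel is `∂K = ∫ q u dν` for the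
score `q = ∂K/K` and `u = K(·,r;y,s) ≥ 0`; one splits at a level `h`, uses Cauchy–Schwarz on
`{q > h}` together with the localized integral bound of Prop. 4.2, and `q ≤ h` elsewhere. This file
isolates that step as pure measure theory on a probability space
(`integral_mul_le_sqrt_mul_of_local_sq_bound`): if `∫_X φ² dν ≤ c_L ν(X)(1 − log ν(X))` for all
Borel `X` and `∫ u² dν ≤ U₂²`, then for every `a ∈ (0,1]`,
`∫ φ u dν ≤ √(c_L (1 − log a)) (√a U₂ + ∫ u dν)` — the level is `λ = √(c_L(1 − log a))`, whose
superlevel set has measure `≤ a` by the sub-Gaussian tail implicit in the localized bound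
(`le_exp_one_sub_of_sq_mul_le`). Also: Cauchy–Schwarz on a set for bounded functions
(`setIntegral_mul_le_sqrt_mul_sqrt`) and the monotonicity of `b ↦ b(1 − log b)` on `[0,1]`
(`mul_one_sub_log_mono`). Everything proved; no definitions.

## References

* R. H. Bamler, *Entropy and heat kernel bounds on a Ricci flow background*, arXiv:2008.07093
  (2020), §7.4, (7.29)–(7.31). [Bamler2020Entropy]
-/

noncomputable section

open Set Filter Function MeasureTheory Measure
open scoped Topology ENNReal NNReal

namespace Literature.Geometry.Riemannian

/-! ### Two real-variable lemmas -/

/-- `b ↦ b (1 − log b)` is monotone on `[0, 1]` (derivative `−log b ≥ 0`). [folklore] -/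
theorem mul_one_sub_log_mono {a b : ℝ} (hb : 0 ≤ b) (hba : b ≤ a) (ha : a ≤ 1) :
    b * (1 - Real.log b) ≤ a * (1 - Real.log a) := by
  have e : ∀ x : ℝ, x * (1 - Real.log x) = x + Real.negMulLog x := fun x ↦ by
    rw [Real.negMulLog]; ring
  rw [e, e]
  have hmono : MonotoneOn (fun x : ℝ ↦ x + Real.negMulLog x) (Icc 0 1) := by
    refine monotoneOn_of_deriv_nonneg (convex_Icc 0 1)
      ((continuous_id.add Real.continuous_negMulLog).continuousOn) ?_ ?_
    · rw [interior_Icc]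
      intro x hx
      exact (differentiableAt_id.add (Real.differentiableAt_negMulLog hx.1.ne')).differentiableWithinAt
    · rw [interior_Icc]
      intro x hx
      have hd : HasDerivAt (fun x : ℝ ↦ x + Real.negMulLog x) (1 + (-Real.log x - 1)) x :=
        (hasDerivAt_id x).add (Real.hasDerivAt_negMulLog hx.1.ne')
      rw [hd.deriv]
      have : Real.log x < 0 := Real.log_neg hx.1 hx.2
      linarith
  exact hmono ⟨hb, hba.trans ha⟩ ⟨hb.trans hba, ha⟩ hba

/-- From `λ² b ≤ c b (1 − log b)` (`c > 0`, `0 ≤ b ≤ 1`): `b ≤ exp(1 − λ²/c)`. [folklore] -/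
theorem le_exp_one_sub_of_sq_mul_le {lam b c : ℝ} (hc : 0 < c) (hb0 : 0 ≤ b) (hb1 : b ≤ 1)
    (h : lam ^ 2 * b ≤ c * b * (1 - Real.log b)) : b ≤ Real.exp (1 - lam ^ 2 / c) := by
  rcases eq_or_lt_of_le hb0 with rfl | hbpos
  · exact (Real.exp_pos _).le
  · have h1 : lam ^ 2 ≤ c * (1 - Real.log b) := by
      have : lam ^ 2 * b ≤ (c * (1 - Real.log b)) * b := by linarith
      exact le_of_mul_le_mul_right this hbpos
    have h2 : lam ^ 2 / c ≤ 1 - Real.log b := by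
      rw [div_le_iff₀ hc]; linarith
    have h3 : Real.log b ≤ 1 - lam ^ 2 / c := by linarith
    calc b = Real.exp (Real.log b) := (Real.exp_log hbpos).symm
      _ ≤ Real.exp (1 - lam ^ 2 / c) := Real.exp_le_exp.2 h3



/-! ### Measure-theoretic lemmas: Cauchy–Schwarz on a set and the score-splitting bound -/

section Splitting

variable {X : Type*} [MeasurableSpace X]

/-- **Cauchy–Schwarz for a set integral** of two bounded measurable functions that are
non-negative on the set. [folklore] -/
theorem setIntegral_mul_le_sqrt_mul_sqrt (ν : Measure X) [IsFiniteMeasure ν] {S : Set X}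
    (hS : MeasurableSet S) {f g : X → ℝ} (hfm : Measurable f) (hgm : Measurable g)
    (hfb : ∃ B : ℝ, ∀ x, |f x| ≤ B) (hgb : ∃ B : ℝ, ∀ x, |g x| ≤ B) (hf0 : ∀ x ∈ S, 0 ≤ f x)
    (hg0 : ∀ x, 0 ≤ g x) :
    ∫ x in S, f x * g x ∂ν ≤
      Real.sqrt (∫ x in S, f x ^ 2 ∂ν) * Real.sqrt (∫ x in S, g x ^ 2 ∂ν) := by
  obtain ⟨Bf, hBf⟩ := hfb
  obtain ⟨Bg, hBg⟩ := hgb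
  have hf_nn : 0 ≤ᵐ[ν.restrict S] f := by
    rw [EventuallyLE, ae_restrict_iff' hS]
    exact Eventually.of_forall hf0
  have hg_nn : 0 ≤ᵐ[ν.restrict S] g := Eventually.of_forall hg0
  have hfL : MemLp f (ENNReal.ofReal 2) (ν.restrict S) := by
    refine MemLp.of_bound hfm.aestronglyMeasurable Bf (Eventually.of_forall fun x ↦ ?_)
    rw [Real.norm_eq_abs]; exact hBf x
  have hgL : MemLp g (ENNReal.ofReal 2) (ν.restrict S) := by
    refine MemLp.of_bound hgm.aestronglyMeasurable Bg (Eventually.of_forall fun x ↦ ?_)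
    rw [Real.norm_eq_abs]; exact hBg x
  have h := integral_mul_le_Lp_mul_Lq_of_nonneg Real.HolderConjugate.two_two hf_nn hg_nn hfL hgL
  have e2 : ∀ (u : X → ℝ), (∫ x in S, u x ^ (2 : ℝ) ∂ν) ^ (1 / (2 : ℝ)) =
      Real.sqrt (∫ x in S, u x ^ 2 ∂ν) := by
    intro u
    rw [Real.sqrt_eq_rpow]
    congr 1
    refine integral_congr_ae (Eventually.of_forall fun x ↦ ?_)
    exact Real.rpow_two (u x)
  rw [e2 f, e2 g] at h
  exact h

/-- **Score splitting** (the measure-theoretic core of Bamler's proof of Thm. 7.5, §7.4): on a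
probability space let `φ` (the score `±∂K/K`) be bounded measurable with the localized
second-moment bound `∫_X φ² ≤ c_L ν(X)(1 − log ν(X))` for all Borel `X`, and let `u ≥ 0` be
bounded measurable with `∫ u² ≤ U₂²`. Then for every `a ∈ (0,1]`,
`∫ φ u dν ≤ √(c_L (1 − log a)) (√a U₂ + ∫ u dν)`: split at the level `λ = √(c_L(1 − log a))`,
whose superlevel set has measure `≤ a` by the sub-Gaussian tail implicit in the localized bound,
and use Cauchy–Schwarz there. [cite: Bamler2020Entropy, §7.4, displays (7.29)–(7.31)] -/
theorem integral_mul_le_sqrt_mul_of_local_sq_bound (ν : Measure X) [IsProbabilityMeasure ν]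
    {φ u : X → ℝ} (hφm : Measurable φ) (hφb : ∃ B : ℝ, ∀ x, |φ x| ≤ B) (hum : Measurable u)
    (hub : ∃ B : ℝ, ∀ x, |u x| ≤ B) (hu0 : ∀ x, 0 ≤ u x) {cL : ℝ} (hcL : 0 < cL)
    (hloc : ∀ Y : Set X, MeasurableSet Y →
      ∫ x in Y, φ x ^ 2 ∂ν ≤ cL * ν.real Y * (1 - Real.log (ν.real Y)))
    {U₂ : ℝ} (hU₂ : 0 ≤ U₂) (hu2 : ∫ x, u x ^ 2 ∂ν ≤ U₂ ^ 2) {a : ℝ} (ha0 : 0 < a) (ha1 : a ≤ 1) :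
    ∫ x, φ x * u x ∂ν ≤ Real.sqrt (cL * (1 - Real.log a)) * (Real.sqrt a * U₂ + ∫ x, u x ∂ν) := by
  obtain ⟨Bφ, hBφ⟩ := hφb
  obtain ⟨Bu, hBu⟩ := hub
  have hloga : Real.log a ≤ 0 := Real.log_nonpos ha0.le ha1
  have h1a : 1 ≤ 1 - Real.log a := by linarith
  set lam : ℝ := Real.sqrt (cL * (1 - Real.log a)) with hlam
  have hlam0 : 0 < lam := Real.sqrt_pos.2 (by positivity)
  have hlamsq : lam ^ 2 = cL * (1 - Real.log a) := Real.sq_sqrt (by positivity)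
  set S : Set X := {x | lam < φ x} with hS
  have hSm : MeasurableSet S := measurableSet_lt measurable_const hφm
  set b : ℝ := ν.real S with hb
  have hb0 : 0 ≤ b := measureReal_nonneg
  have hb1 : b ≤ 1 := measureReal_le_one
  -- integrability facts
  have hφi : Integrable φ ν := Integrable.of_bound hφm.aestronglyMeasurable Bφ
    (Eventually.of_forall fun x ↦ by rw [Real.norm_eq_abs]; exact hBφ x)
  have hui : Integrable u ν := Integrable.of_bound hum.aestronglyMeasurable Bu
    (Eventually.of_forall fun x ↦ by rw [Real.norm_eq_abs]; exact hBu x)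
  have hφ2i : Integrable (fun x ↦ φ x ^ 2) ν := by
    refine Integrable.of_bound (hφm.pow_const 2).aestronglyMeasurable (Bφ ^ 2)
      (Eventually.of_forall fun x ↦ ?_)
    rw [Real.norm_eq_abs, abs_pow]
    exact pow_le_pow_left₀ (abs_nonneg _) (hBφ x) 2
  have hu2i : Integrable (fun x ↦ u x ^ 2) ν := by
    refine Integrable.of_bound (hum.pow_const 2).aestronglyMeasurable (Bu ^ 2)
      (Eventually.of_forall fun x ↦ ?_)
    rw [Real.norm_eq_abs, abs_pow]
    exact pow_le_pow_left₀ (abs_nonneg _) (hBu x) 2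
  have hφui : Integrable (fun x ↦ φ x * u x) ν :=
    Integrable.of_bound (hφm.mul hum).aestronglyMeasurable (Bφ * Bu)
      (Eventually.of_forall fun x ↦ by
        rw [Real.norm_eq_abs, abs_mul]
        exact mul_le_mul (hBφ x) (hBu x) (abs_nonneg _) ((abs_nonneg _).trans (hBφ x)))
  -- the superlevel set has measure `≤ a`
  have hba : b ≤ a := by
    have h1 : lam ^ 2 * b ≤ ∫ x in S, φ x ^ 2 ∂ν := by
      have hc : ∫ x in S, lam ^ 2 ∂ν = lam ^ 2 * b := by
        rw [setIntegral_const, smul_eq_mul, mul_comm]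
      rw [← hc]
      refine setIntegral_mono_on (integrableOn_const) hφ2i.integrableOn hSm fun x hx ↦ ?_
      have hx' : lam < φ x := hx
      exact pow_le_pow_left₀ hlam0.le hx'.le 2
    have h2 := h1.trans (hloc S hSm)
    have h3 := le_exp_one_sub_of_sq_mul_le hcL hb0 hb1 h2
    rw [hlamsq, mul_div_cancel_left₀ _ hcL.ne', sub_sub_cancel, Real.exp_log ha0] at h3
    exact h3
  -- on `Sᶜ`: `φ u ≤ λ u`
  have hcompl : ∫ x in Sᶜ, φ x * u x ∂ν ≤ lam * ∫ x, u x ∂ν := by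
    have h1 : ∫ x in Sᶜ, φ x * u x ∂ν ≤ ∫ x in Sᶜ, lam * u x ∂ν := by
      refine setIntegral_mono_on hφui.integrableOn (hui.const_mul lam).integrableOn hSm.compl
        fun x hx ↦ ?_
      have hx' : φ x ≤ lam := not_lt.1 hx
      exact mul_le_mul_of_nonneg_right hx' (hu0 x)
    have h2 : ∫ x in Sᶜ, lam * u x ∂ν ≤ lam * ∫ x, u x ∂ν := by
      rw [integral_const_mul]
      refine mul_le_mul_of_nonneg_left ?_ hlam0.le
      exact setIntegral_le_integral hui (Eventually.of_forall hu0)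
    exact h1.trans h2
  -- on `S`: Cauchy–Schwarz and the localized bound
  have hSpart : ∫ x in S, φ x * u x ∂ν ≤ lam * (Real.sqrt a * U₂) := by
    have hcs := setIntegral_mul_le_sqrt_mul_sqrt ν hSm hφm hum ⟨Bφ, hBφ⟩ ⟨Bu, hBu⟩
      (fun x hx ↦ (hlam0.trans hx).le) hu0
    have hA : Real.sqrt (∫ x in S, φ x ^ 2 ∂ν) ≤ lam * Real.sqrt a := by
      have h1 : ∫ x in S, φ x ^ 2 ∂ν ≤ cL * a * (1 - Real.log a) := by
        refine (hloc S hSm).trans ?_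
        have := mul_one_sub_log_mono hb0 hba ha1
        calc cL * ν.real S * (1 - Real.log (ν.real S)) = cL * (b * (1 - Real.log b)) := by
              rw [hb]; ring
          _ ≤ cL * (a * (1 - Real.log a)) := mul_le_mul_of_nonneg_left this hcL.le
          _ = cL * a * (1 - Real.log a) := by ring
      calc Real.sqrt (∫ x in S, φ x ^ 2 ∂ν) ≤ Real.sqrt (cL * a * (1 - Real.log a)) :=
            Real.sqrt_le_sqrt h1
        _ = lam * Real.sqrt a := by
            rw [hlam, ← Real.sqrt_mul (by positivity)]
            congr 1; ring
    have hB : Real.sqrt (∫ x in S, u x ^ 2 ∂ν) ≤ U₂ := by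
      have h1 : ∫ x in S, u x ^ 2 ∂ν ≤ U₂ ^ 2 :=
        (setIntegral_le_integral hu2i (Eventually.of_forall fun x ↦ sq_nonneg _)).trans hu2
      calc Real.sqrt (∫ x in S, u x ^ 2 ∂ν) ≤ Real.sqrt (U₂ ^ 2) := Real.sqrt_le_sqrt h1
        _ = U₂ := Real.sqrt_sq hU₂
    calc ∫ x in S, φ x * u x ∂ν
        ≤ Real.sqrt (∫ x in S, φ x ^ 2 ∂ν) * Real.sqrt (∫ x in S, u x ^ 2 ∂ν) := hcs
      _ ≤ (lam * Real.sqrt a) * U₂ :=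
          mul_le_mul hA hB (Real.sqrt_nonneg _) (by positivity)
      _ = lam * (Real.sqrt a * U₂) := by ring
  -- assemble
  rw [← integral_add_compl hSm hφui]
  have : lam * (Real.sqrt a * U₂) + lam * ∫ x, u x ∂ν =
      lam * (Real.sqrt a * U₂ + ∫ x, u x ∂ν) := by ring
  linarith [hSpart, hcompl, this]

end Splitting

end Literature.Geometry.Riemannian

end
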